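import Mathlib
import Summits.Ventures.HodgeRepro2.T5HodgeStar
import Summits.Ventures.HodgeRepro2.T5HodgeStarUnique
import Summits.Ventures.HodgeRepro2.T5CoframeInvariance
import Summits.Ventures.HodgeRepro2.T5WedgeDeterminant

/-!
# T5HodgeStarEquivariance — the Hodge operator of the six-coefficient model is the same for every
positively oriented orthonormal coframe, and is negated by an orientation-reversing one
(Tier-5 N1 Hodge-side support, seat p6)

`T5HodgeStar.hodgeStar` is defined by a sign table in ONE orthonormal coframe `(dx₁, dy₁, dx₂, dy₂)`
of `T^*_sS`; Voisin's Definition 5.3 (held copy p0104 ll. 30–38) defines `*` from the metric and the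
orientation alone. This file closes the gap in the model: a change of orthonormal coframe
`g ∈ O(4)` acts on the six coefficients by `Λ²g` (`T5CoframeInvariance.compound g`, here extended to
complex coefficients as `compoundC g`), and

  `*(Λ²g · x) = det g · Λ²g · (*x)`   for every `g` with `gᵀ g = 1`

(`hodgeStar_act`): for `det g = 1` the operator computed in the new coframe is the same operator,
for `det g = −1` it is `−*` — the Hodge operator of the opposite orientation (route/T5-N1-hodge-p6.md
§H4). The proof is the uniqueness of row 44 (`T5HodgeStarUnique.hodgeStar_unique`: `*` is the only
map with `γ ∧ *δ = bil γ δ`) applied to `δ ↦ det g · Λ²g (*(Λ²gᵀ δ))`, using the invariance of the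
bilinear form under `O(4)` (row 40, transported to `ℂ`) and the transformation of the wedge pairing
by `det g` (`T5WedgeDeterminant`, transported to `ℂ`).

Also: `bil_act` / `herm_act` (the bilinear and hermitian forms of the model are `O(4)`-invariant),
`conjC_act` (a real change commutes with conjugation), `wedge_act`, and the characterising identity
`wedge_hodgeStar : γ ∧ *δ = bil γ δ` of the model's operator.

Honest scope: pointwise linear algebra on `Λ²ℝ⁴ ⊗ ℂ`; that a change of orthonormal coframe of `T_sS`
acts on the coefficients by `Λ²g` is row 45; the manifold, the metric as a tensor and the bundles
stay prose. Nothing automorphic.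
-/

namespace Summit.Ventures.HodgeRepro2.T5HodgeStarEquivariance

open Matrix T5HodgeStar T5HodgeStarUnique T5CoframeInvariance T5WedgeDeterminant

/-- The second compound matrix `Λ²g` with complex entries. -/
noncomputable def compoundC (g : Matrix (Fin 4) (Fin 4) ℝ) : Matrix (Fin 6) (Fin 6) ℂ :=
  (compound g).map (algebraMap ℝ ℂ)

/-- The action of a coframe change on the six complex coefficients of a 2-covector. -/
noncomputable def act (g : Matrix (Fin 4) (Fin 4) ℝ) (x : TwoCovector) : TwoCovector := (compoundC g).mulVec x

/-- The wedge-pairing matrix `J` with complex entries. -/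
noncomputable def JC : Matrix (Fin 6) (Fin 6) ℂ := T5WedgeDeterminant.J.map (algebraMap ℝ ℂ)

/-- `Λ²(gh) = Λ²g · Λ²h` over `ℂ`. -/
theorem compoundC_mul (g h : Matrix (Fin 4) (Fin 4) ℝ) :
    compoundC (g * h) = compoundC g * compoundC h := by
  simp only [compoundC, compound_mul, Matrix.map_mul]

/-- `Λ²(gᵀ) = (Λ²g)ᵀ` over `ℂ`. -/
theorem compoundC_transpose (g : Matrix (Fin 4) (Fin 4) ℝ) : compoundC gᵀ = (compoundC g)ᵀ := by
  simp only [compoundC, compound_transpose, Matrix.transpose_map]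

/-- `Λ²1 = 1` over `ℂ`. -/
theorem compoundC_one : compoundC 1 = 1 := by
  simp only [compoundC, compound_one, Matrix.map_one (algebraMap ℝ ℂ) (map_zero _) (map_one _)]

/-- `gᵀ g = 1 ⇒ (Λ²g)ᵀ Λ²g = 1` over `ℂ`. -/
theorem compoundC_orthogonal (g : Matrix (Fin 4) (Fin 4) ℝ) (hg : gᵀ * g = 1) :
    (compoundC g)ᵀ * compoundC g = 1 := by
  rw [← compoundC_transpose, ← compoundC_mul, hg, compoundC_one]

/-- `gᵀ g = 1 ⇒ Λ²g (Λ²g)ᵀ = 1` over `ℂ`. -/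
theorem compoundC_mul_transpose (g : Matrix (Fin 4) (Fin 4) ℝ) (hg : gᵀ * g = 1) :
    compoundC g * (compoundC g)ᵀ = 1 :=
  mul_eq_one_comm.mp (compoundC_orthogonal g hg)

/-- `act (g h) = act g ∘ act h`. -/
theorem act_act (g h : Matrix (Fin 4) (Fin 4) ℝ) (x : TwoCovector) :
    act g (act h x) = act (g * h) x := by
  simp only [act, mulVec_mulVec, compoundC_mul]

/-- `act 1 = id`. -/
theorem act_one (x : TwoCovector) : act 1 x = x := by
  simp only [act, compoundC_one, one_mulVec]

/-- For an orthogonal `g`, `act gᵀ` inverts `act g`. -/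
theorem act_transpose_act (g : Matrix (Fin 4) (Fin 4) ℝ) (hg : gᵀ * g = 1) (x : TwoCovector) :
    act gᵀ (act g x) = x := by
  rw [act_act, hg, act_one]

/-- For an orthogonal `g`, `act g` inverts `act gᵀ`. -/
theorem act_act_transpose (g : Matrix (Fin 4) (Fin 4) ℝ) (hg : gᵀ * g = 1) (x : TwoCovector) :
    act g (act gᵀ x) = x := by
  rw [act_act, mul_eq_one_comm.mp hg, act_one]

/-- The bilinear form of row 44 is the dot product. -/
theorem bil_eq_dotProduct (γ δ : TwoCovector) : bil γ δ = γ ⬝ᵥ δ := rfl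

/-- The bilinear form `Σ γ_i δ_i` is invariant under an orthogonal coframe change. -/
theorem bil_act (g : Matrix (Fin 4) (Fin 4) ℝ) (hg : gᵀ * g = 1) (x y : TwoCovector) :
    bil (act g x) (act g y) = bil x y := by
  simp only [bil_eq_dotProduct, act]
  rw [dotProduct_mulVec, ← vecMul_transpose, vecMul_vecMul, compoundC_orthogonal g hg, vecMul_one]

/-- A real coframe change commutes with conjugation of the coefficients. -/
theorem conjC_act (g : Matrix (Fin 4) (Fin 4) ℝ) (x : TwoCovector) :
    conjC (act g x) = act g (conjC x) := by
  funext i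
  simp [conjC, act, compoundC, mulVec, dotProduct, map_sum]

/-- The hermitian form is the bilinear form against the conjugate. -/
theorem herm_eq_bil_conjC (γ δ : TwoCovector) : herm γ δ = bil γ (conjC δ) := rfl

/-- The hermitian form `(γ, δ) = Σ γ_i \overline{δ_i}` is invariant under an orthogonal coframe change
(row 40's `dotProduct_compound_mulVec` for its hermitian extension). -/
theorem herm_act (g : Matrix (Fin 4) (Fin 4) ℝ) (hg : gᵀ * g = 1) (x y : TwoCovector) :
    herm (act g x) (act g y) = herm x y := by
  rw [herm_eq_bil_conjC, conjC_act, bil_act g hg, herm_eq_bil_conjC]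

/-- The wedge pairing of the model is the bilinear form with matrix `JC`. -/
theorem wedge_eq_dotProduct (x y : TwoCovector) : wedge x y = x ⬝ᵥ JC.mulVec y := by
  simp [wedge, JC, T5WedgeDeterminant.J, dotProduct, mulVec, Fin.sum_univ_six]
  ring

/-- `(Λ²g)ᵀ JC (Λ²g) = det g · JC` over `ℂ` (transport of `T5WedgeDeterminant`). -/
theorem transpose_compoundC_mul_JC_mul_compoundC (g : Matrix (Fin 4) (Fin 4) ℝ) :
    (compoundC g)ᵀ * JC * compoundC g = (g.det : ℂ) • JC := by
  have h := congrArg (fun M : Matrix (Fin 6) (Fin 6) ℝ => M.map (algebraMap ℝ ℂ))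
    (transpose_compound_mul_J_mul_compound g)
  simp only [Matrix.map_mul, Matrix.transpose_map] at h
  rw [compoundC, JC, h]
  ext i j
  simp [Matrix.map_apply]

/-- `wedge(Λ²g x, Λ²g y) = det g · wedge(x, y)` for complex coefficients. -/
theorem wedge_act (g : Matrix (Fin 4) (Fin 4) ℝ) (x y : TwoCovector) :
    wedge (act g x) (act g y) = (g.det : ℂ) * wedge x y := by
  simp only [wedge_eq_dotProduct, act]
  rw [mulVec_mulVec, dotProduct_mulVec, ← vecMul_transpose, vecMul_vecMul, ← Matrix.mul_assoc,
    transpose_compoundC_mul_JC_mul_compoundC, vecMul_smul, smul_dotProduct, smul_eq_mul,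
    dotProduct_mulVec]

/-- The characterising identity of the model's Hodge operator: `γ ∧ *δ = bil γ δ` (Voisin Def. 5.3
read with the bilinear extension; row 44 shows it determines `*`). -/
theorem wedge_hodgeStar (γ δ : TwoCovector) : wedge γ (hodgeStar δ) = bil γ δ := by
  simp [wedge, hodgeStar, bil, Fin.sum_univ_six]
  ring

/-- `(det g)² = 1` for an orthogonal `g`. -/
theorem det_mul_det_eq_one (g : Matrix (Fin 4) (Fin 4) ℝ) (hg : gᵀ * g = 1) : g.det * g.det = 1 := by
  have := congrArg Matrix.det hg
  rwa [det_mul, det_transpose, det_one] at this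

/-- **The Hodge operator is `O(4)`-equivariant up to the orientation sign**: for `gᵀ g = 1`,
`*(Λ²g · x) = det g · Λ²g · (*x)`. For `det g = 1` (a positively oriented orthonormal coframe) the
operator defined by the sign table in the new coframe is the SAME operator — Definition 5.3 depends
only on the metric and the orientation; for `det g = −1` it is `−*`, the operator of the opposite
orientation. -/
theorem hodgeStar_act (g : Matrix (Fin 4) (Fin 4) ℝ) (hg : gᵀ * g = 1) (x : TwoCovector) :
    hodgeStar (act g x) = (g.det : ℂ) • act g (hodgeStar x) := by
  have hgt : gᵀᵀ * gᵀ = 1 := by rw [transpose_transpose]; exact mul_eq_one_comm.mp hg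
  let T : TwoCovector → TwoCovector := fun δ => (g.det : ℂ) • act g (hodgeStar (act gᵀ δ))
  have hT : ∀ γ δ, wedge γ (T δ) = bil γ δ := by
    intro γ δ
    have h1 : wedge γ (T δ) = (g.det : ℂ) * wedge γ (act g (hodgeStar (act gᵀ δ))) := by
      simp only [T, wedge_eq_dotProduct, mulVec_smul, dotProduct_smul, smul_eq_mul]
    rw [h1]
    conv_lhs => rw [← act_act_transpose g hg γ]
    rw [wedge_act, wedge_hodgeStar, bil_act gᵀ hgt, ← mul_assoc, ← Complex.ofReal_mul,
      det_mul_det_eq_one g hg, Complex.ofReal_one, one_mul]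
  have hTeq : T = hodgeStar := hodgeStar_unique T hT
  have := congrFun hTeq (act g x)
  rw [← this]
  simp only [T, act_transpose_act g hg]

/-- A positively oriented orthonormal coframe change leaves the Hodge operator unchanged. -/
theorem hodgeStar_act_of_det_eq_one (g : Matrix (Fin 4) (Fin 4) ℝ) (hg : gᵀ * g = 1)
    (hd : g.det = 1) (x : TwoCovector) : hodgeStar (act g x) = act g (hodgeStar x) := by
  rw [hodgeStar_act g hg, hd]; simp

/-- An orientation-reversing orthonormal coframe change replaces the Hodge operator by `−*`. -/
theorem hodgeStar_act_of_det_eq_neg_one (g : Matrix (Fin 4) (Fin 4) ℝ) (hg : gᵀ * g = 1)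
    (hd : g.det = -1) (x : TwoCovector) : hodgeStar (act g x) = -act g (hodgeStar x) := by
  rw [hodgeStar_act g hg, hd]; simp

end Summit.Ventures.HodgeRepro2.T5HodgeStarEquivariance
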